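import Summits.CriticalPhenomena.Ising3DConformalLimit.Theorems.ExistsScaleCovariantLimit.Negative.TightnessUniqueness
import Summits.CriticalPhenomena.Ising3DConformalLimit.Theorems.HyperoctahedralRPExistsScaleCovariantLimitDyadicLimitContinuous
import HarnessLib

/-!
# Asymptotic scale redundancy of the pinned zoom under item 5955; cluster points live on the harmonic meshes
# (support file 3/3 of F4 `stub_clusterPointUnique`, crux `ExistsScaleCovariantLimit`, item stmt-CriticalPhenomena-1981,
# line `folded-current-repulsion`)

Route `HyperoctahedralRP` / `GaussianScaleMixture` (sub-problem `CriticalPhenomena/Ising3DConformalLimit`), crux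
`Summit.CriticalPhenomena.Ising3DConformalLimit.Theses.HyperoctahedralRP.ExistsScaleCovariantLimit`. Part C of the
reduction `item 5955 ∧ item 4659 ⟹ ClusterPointUnique` (file
`Theorems/HyperoctahedralRPExistsScaleCovariantLimitFoldedCurrentUniqueness.lean`), about the pinned zoom
`pz n δ x = rescaledCorrelator (criticalCorr 3) rhoPin n δ x` of the critical `ℤ³` Ising correlators
(`ρ_pin(δ) = ⟨σ₀σ_{⌊1/δ⌋e₀}⟩^{-1/2}`):

* `tight_nhdsGT` — item 5955 `MonotoneRG.OrbitPrecompact` gives tightness along EVERY `u_k → 0⁺` (the landed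
  `tight_of_orbitPrecompact` after a shift removing the clamp `u_k ∈ (0,1]`, true eventually);
* `seqLimit_eqOn_of_ratio` — ASYMPTOTIC SCALE REDUNDANCY, pointwise: limits along `u_k` and along `w_k` with
  `u_k/w_k → 1` agree off the diagonals, by the exact re-pinning identity `pz n (s⁻¹δ) x = pz 2 δ (0, s e₀)^{-n/2} ·
  pz n δ (s·x)` (`pz_scale`), the automatic continuity of sequential limits off the diagonals (`continuousOn_seqLimit`)
  and the pinning `S 2 (0,e₀) = 1` (`clusterPoint_cfg01`); `tluo_of_ratio` — the locally uniform form under item 5955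
  (sub-subsequence argument);
* `exists_harmonic_subseq` (registered sub-goal of the line) — under item 5955 every cluster point of the pinned zoom
  is a locally uniform limit along a
  subsequence of the HARMONIC meshes `1/(m+1)` (compare `u_k` with `1/(⌊1/u_k⌋₊+1)`); `harmonic_ratio_tendsto`.

Folklore; inputs are landed tree theorems only. No definitions; no `sorry`.
-/

noncomputable section

namespace Summit.CriticalPhenomena.Ising3DConformalLimit.Cruxes.ExistsScaleCovariantLimit.FoldedCurrentRepulsion

open Filter Set
open scoped Topology

namespace Uniqueness

section Zoom

open Literature.Probability.LatticeModels
open Summit.CriticalPhenomena.Ising3DConformalLimit.MoebiusLimitExistsOnlyInteraction (rhoPin IsClusterPoint)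
open Summit.CriticalPhenomena.Ising3DConformalLimit.Theses
open Summit.CriticalPhenomena.Ising3DConformalLimit.MoebiusLimitExistsNegative (tendsto_div_succ_nhdsGT)
open Summit.CriticalPhenomena.Ising3DConformalLimit.ExistsScaleCovariantLimitNegative (tight_of_orbitPrecompact)
open Summit.CriticalPhenomena.Ising3DConformalLimit.ExistsScaleCovariantLimitNegative.Dyadic (pz_scale smul_cfg01)
open Summit.CriticalPhenomena.Ising3DConformalLimit.PinnedClusterPoints (cfg01_mem clusterPoint_cfg01)
open Summit.CriticalPhenomena.Ising3DConformalLimit.Cruxes.ExistsScaleCovariantLimit.TwoHierarchies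
  (continuousOn_seqLimit)

/-- **Tightness of the pinned zoom along every mesh sequence `u_k → 0⁺`** (item 5955 `OrbitPrecompact` via the landed
`tight_of_orbitPrecompact`; the clamp `u_k ∈ (0,1]` holds eventually and is removed by a shift of the sequence).
[folklore] -/
theorem tight_nhdsGT (hpc : MonotoneRG.OrbitPrecompact) {u : ℕ → ℝ} (hu : Tendsto u atTop (𝓝[>] (0:ℝ))) :
    ∃ φ : ℕ → ℕ, StrictMono φ ∧ ∃ S : CorrFamily 3, ∀ n,
      TendstoLocallyUniformlyOn (fun k => rescaledCorrelator (criticalCorr 3) rhoPin n (u (φ k))) (S n) atTop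
        (NonCoincident 3 n) := by
  have hev : ∀ᶠ k in atTop, u k ∈ Set.Ioc (0:ℝ) 1 := hu.eventually (Ioc_mem_nhdsGT one_pos)
  obtain ⟨N, hN⟩ := eventually_atTop.1 hev
  have hu' : Tendsto (fun k => u (k + N)) atTop (𝓝[>] (0:ℝ)) := hu.comp (tendsto_add_atTop_nat N)
  obtain ⟨φ, hφ, S, hS⟩ := tight_of_orbitPrecompact hpc (fun k => u (k + N)) (fun k => hN _ (by omega)) hu'
  exact ⟨fun k => φ k + N, fun a b hab => by simpa using hφ hab, S, fun n => hS n⟩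

/-- A subsequence of a locally uniformly convergent zoom sequence converges locally uniformly. [folklore] -/
theorem zoom_subseq {u : ℕ → ℝ} {n : ℕ} {f : (Fin n → EuclideanSpace ℝ (Fin 3)) → ℝ}
    (h : TendstoLocallyUniformlyOn (fun k => rescaledCorrelator (criticalCorr 3) rhoPin n (u k)) f atTop
      (NonCoincident 3 n)) {φ : ℕ → ℕ} (hφ : StrictMono φ) :
    TendstoLocallyUniformlyOn (fun k => rescaledCorrelator (criticalCorr 3) rhoPin n (u (φ k))) f atTop
      (NonCoincident 3 n) := by
  intro v hv x hx
  obtain ⟨t, ht, hev⟩ := h v hv x hx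
  exact ⟨t, ht, hφ.tendsto_atTop.eventually hev⟩

/-- The dilated configurations `s_k • x → x` within `NonCoincident`, for `s_k → 1`. [folklore] -/
theorem tendsto_smul_cfg_nhdsWithin {n : ℕ} {x : Fin n → EuclideanSpace ℝ (Fin 3)} (hx : x ∈ NonCoincident 3 n)
    {s : ℕ → ℝ} (hs : Tendsto s atTop (𝓝 1)) :
    Tendsto (fun k => fun i => s k • x i) atTop (𝓝[NonCoincident 3 n] x) := by
  refine tendsto_nhdsWithin_iff.2 ⟨?_, ?_⟩
  · have h : Tendsto (fun k => fun i => s k • x i) atTop (𝓝 (fun i => (1:ℝ) • x i)) :=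
      tendsto_pi_nhds.2 fun i => hs.smul_const (x i)
    simpa using h
  · have hne : ∀ᶠ k in atTop, s k ≠ 0 := hs.eventually (isOpen_ne.mem_nhds one_ne_zero)
    exact hne.mono fun k hk => smul_mem_nonCoincident hk hx

/-- **Asymptotic scale redundancy, pointwise.** If the pinned zoom converges to `S` along `u_k → 0⁺` (all orders,
locally uniformly off the diagonals) and to `S'` along `w_k → 0⁺` with `u_k / w_k → 1`, then `S' = S` off the
diagonals: by the exact re-pinning identity `pz n (s⁻¹δ) x = pz 2 δ (0, s e₀)^{-n/2} · pz n δ (s·x)` (`pz_scale`),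
the automatic continuity of `S` off the diagonals (`continuousOn_seqLimit`) and the pinning `S 2 (0,e₀) = 1`
(`clusterPoint_cfg01`). [folklore] -/
theorem seqLimit_eqOn_of_ratio {u w : ℕ → ℝ} (hu : Tendsto u atTop (𝓝[>] (0:ℝ)))
    (hw : Tendsto w atTop (𝓝[>] (0:ℝ))) (hr : Tendsto (fun k => u k / w k) atTop (𝓝 1))
    {S S' : CorrFamily 3}
    (hS : ∀ n, TendstoLocallyUniformlyOn (fun k => rescaledCorrelator (criticalCorr 3) rhoPin n (u k)) (S n) atTop
      (NonCoincident 3 n))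
    (hS' : ∀ n, TendstoLocallyUniformlyOn (fun k => rescaledCorrelator (criticalCorr 3) rhoPin n (w k)) (S' n) atTop
      (NonCoincident 3 n)) (n : ℕ) :
    Set.EqOn (S' n) (S n) (NonCoincident 3 n) := by
  intro x hx
  have hupos : ∀ᶠ k in atTop, 0 < u k := hu.eventually self_mem_nhdsWithin
  have hwpos : ∀ᶠ k in atTop, 0 < w k := hw.eventually self_mem_nhdsWithin
  set s : ℕ → ℝ := fun k => u k / w k with hs
  set c : Fin 2 → EuclideanSpace ℝ (Fin 3) := ![0, EuclideanSpace.single 0 1] with hc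
  -- the identity, eventually
  have hid : ∀ᶠ k in atTop, rescaledCorrelator (criticalCorr 3) rhoPin n (w k) x =
      (rescaledCorrelator (criticalCorr 3) rhoPin 2 (u k) (fun i => s k • c i)) ^ (-(n:ℝ) / 2) *
        rescaledCorrelator (criticalCorr 3) rhoPin n (u k) (fun i => s k • x i) := by
    filter_upwards [hupos, hwpos] with k hku hkw
    have hsk : 0 < s k := div_pos hku hkw
    have e : w k = (s k)⁻¹ * u k := by
      simp only [hs]
      field_simp
    rw [e, pz_scale hsk hku n x, hc, smul_cfg01]
  -- limits of the factors
  have hS2 : S 2 c = 1 := clusterPoint_cfg01 ⟨u, hu, hS⟩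
  have hcont : ∀ m, ContinuousOn (S m) (NonCoincident 3 m) := fun m => continuousOn_seqLimit hu (hS m)
  have h1 : Tendsto (fun k => rescaledCorrelator (criticalCorr 3) rhoPin n (u k) (fun i => s k • x i)) atTop
      (𝓝 (S n x)) :=
    (hS n).tendsto_comp (hcont n x hx) hx (tendsto_smul_cfg_nhdsWithin hx hr)
  have h2 : Tendsto (fun k => rescaledCorrelator (criticalCorr 3) rhoPin 2 (u k) (fun i => s k • c i)) atTop
      (𝓝 1) := by
    rw [← hS2]
    exact (hS 2).tendsto_comp (hcont 2 c cfg01_mem) cfg01_mem (tendsto_smul_cfg_nhdsWithin cfg01_mem hr)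
  have h3 : Tendsto (fun k => (rescaledCorrelator (criticalCorr 3) rhoPin 2 (u k) (fun i => s k • c i)) ^ (-(n:ℝ) / 2))
      atTop (𝓝 1) := by
    have h := h2.rpow_const (p := -(n:ℝ) / 2) (Or.inl one_ne_zero)
    rwa [Real.one_rpow] at h
  have h4 : Tendsto (fun k => rescaledCorrelator (criticalCorr 3) rhoPin n (w k) x) atTop (𝓝 (S n x)) := by
    have h := h3.mul h1
    rw [one_mul] at h
    exact h.congr' (hid.mono fun k hk => hk.symm)
  exact tendsto_nhds_unique ((hS' n).tendsto_at hx) h4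

/-- **Asymptotic scale redundancy of the pinned zoom** (given item 5955): if the pinned zoom converges to `S` along
`u_k → 0⁺` (all orders, locally uniformly off the diagonals), it converges to the same `S` along every `w_k → 0⁺`
with `u_k / w_k → 1` (sub-subsequence argument: a bad subsequence has, by tightness, a convergent sub-subsequence,
whose limit is `S` by `seqLimit_eqOn_of_ratio`). [folklore] -/
theorem tluo_of_ratio (hpc : MonotoneRG.OrbitPrecompact) {u w : ℕ → ℝ} (hu : Tendsto u atTop (𝓝[>] (0:ℝ)))
    (hw : Tendsto w atTop (𝓝[>] (0:ℝ))) (hr : Tendsto (fun k => u k / w k) atTop (𝓝 1)) {S : CorrFamily 3}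
    (hS : ∀ n, TendstoLocallyUniformlyOn (fun k => rescaledCorrelator (criticalCorr 3) rhoPin n (u k)) (S n) atTop
      (NonCoincident 3 n)) (n : ℕ) :
    TendstoLocallyUniformlyOn (fun k => rescaledCorrelator (criticalCorr 3) rhoPin n (w k)) (S n) atTop
      (NonCoincident 3 n) := by
  rw [tendstoLocallyUniformlyOn_iff_forall_isCompact (isOpen_nonCoincident 3 n)]
  intro K hK hKc
  rw [Metric.tendstoUniformlyOn_iff]
  intro ε hε
  by_contra hnot
  obtain ⟨φ, hφ, hbad⟩ := extraction_of_frequently_atTop (not_eventually.1 hnot)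
  obtain ⟨ψ, hψ, S', hS'⟩ := tight_nhdsGT hpc (hw.comp hφ.tendsto_atTop)
  have hφψ : StrictMono (φ ∘ ψ) := hφ.comp hψ
  have heq : ∀ m, Set.EqOn (S' m) (S m) (NonCoincident 3 m) :=
    seqLimit_eqOn_of_ratio (u := fun l => u (φ (ψ l))) (w := fun l => w (φ (ψ l))) (hu.comp hφψ.tendsto_atTop)
      (hw.comp hφψ.tendsto_atTop) (hr.comp hφψ.tendsto_atTop)
      (fun m => zoom_subseq (hS m) hφψ) hS'
  have hK' := (tendstoLocallyUniformlyOn_iff_forall_isCompact (isOpen_nonCoincident 3 n)).1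
    ((hS' n).congr_right (heq n)) K hK hKc
  obtain ⟨l, hl⟩ := ((Metric.tendstoUniformlyOn_iff.1 hK') ε hε).exists
  exact hbad (ψ l) hl

/-- The ratio of consecutive harmonic meshes tends to one: `(1/(m+1)) / (1/(m+2)) → 1`. [folklore] -/
theorem harmonic_ratio_tendsto :
    Tendsto (fun m : ℕ => (1 / ((m:ℝ) + 1)) / (1 / (((m + 1 : ℕ) : ℝ) + 1))) atTop (𝓝 1) := by
  have h : Tendsto (fun m : ℕ => 1 + 1 / ((m:ℝ) + 1)) atTop (𝓝 1) := by
    simpa using (tendsto_const_nhds (x := (1:ℝ))).add tendsto_one_div_add_atTop_nhds_zero_nat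
  refine h.congr fun m => ?_
  have h1 : (m:ℝ) + 1 ≠ 0 := by positivity
  have h2 : (m:ℝ) + 1 + 1 ≠ 0 := by positivity
  push_cast
  field_simp

/-- **Every cluster point is a cluster point along the harmonic meshes `1/(m+1)`** (given item 5955): compare `u_k`
with `1/(⌊1/u_k⌋₊ + 1)`, whose ratio to `u_k` tends to one, and use `tluo_of_ratio`. [folklore] -/
theorem exists_harmonic_subseq : MonotoneRG.OrbitPrecompact → ∀ S : CorrFamily 3, IsClusterPoint S →
    ∃ φ : ℕ → ℕ, StrictMono φ ∧ ∀ n,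
      TendstoLocallyUniformlyOn (fun k => rescaledCorrelator (criticalCorr 3) rhoPin n (1 / (((φ k : ℕ) : ℝ) + 1)))
        (S n) Filter.atTop (NonCoincident 3 n) := by
  intro hpc S hS
  obtain ⟨u, hu, hconv⟩ := hS
  have hu0 : Tendsto u atTop (𝓝 0) := (tendsto_nhdsWithin_iff.1 hu).1
  have hupos : ∀ᶠ k in atTop, 0 < u k := hu.eventually self_mem_nhdsWithin
  set m : ℕ → ℕ := fun k => ⌊(u k)⁻¹⌋₊ with hm
  have hm_top : Tendsto m atTop atTop := tendsto_nat_floor_atTop.comp hu.inv_tendsto_nhdsGT_zero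
  -- the ratio `u_k (m_k + 1) → 1`
  have hratio : Tendsto (fun k => u k / (1 / (((m k : ℕ) : ℝ) + 1))) atTop (𝓝 1) := by
    have hup : Tendsto (fun k => 1 + u k) atTop (𝓝 1) := by simpa using tendsto_const_nhds.add hu0
    refine tendsto_of_tendsto_of_tendsto_of_le_of_le' tendsto_const_nhds hup ?_ ?_
    · filter_upwards [hupos] with k hk
      have h1 : (u k)⁻¹ < (m k : ℝ) + 1 := Nat.lt_floor_add_one _
      rw [div_div_eq_mul_div, div_one]
      have h2 : (u k)⁻¹ * u k = 1 := inv_mul_cancel₀ hk.ne'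
      nlinarith
    · filter_upwards [hupos] with k hk
      have h1 : (m k : ℝ) ≤ (u k)⁻¹ := Nat.floor_le (inv_nonneg.2 hk.le)
      rw [div_div_eq_mul_div, div_one]
      have h2 : (u k)⁻¹ * u k = 1 := inv_mul_cancel₀ hk.ne'
      nlinarith
  obtain ⟨κ, hκ, hmκ⟩ := strictMono_subseq_of_tendsto_atTop hm_top
  refine ⟨m ∘ κ, hmκ, fun n => ?_⟩
  exact tluo_of_ratio hpc (u := fun k => u (κ k)) (w := fun k => 1 / ((((m ∘ κ) k : ℕ) : ℝ) + 1))
    (hu.comp hκ.tendsto_atTop) ((tendsto_div_succ_nhdsGT one_pos).comp hmκ.tendsto_atTop)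
    (hratio.comp hκ.tendsto_atTop) (fun n' => zoom_subseq (hconv n') hκ) n

end Zoom

end Uniqueness

end Summit.CriticalPhenomena.Ising3DConformalLimit.Cruxes.ExistsScaleCovariantLimit.FoldedCurrentRepulsion

end
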